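import Mathlib
import Summits.ValiantsHypothesis.ValiantsHypothesis.Theorems.LiouvilleSarnakLiouvilleCutRankOneScaleWindowEmbedding
import Summits.ValiantsHypothesis.ValiantsHypothesis.Theorems.LiouvilleSarnakLiouvilleCutRankBoundedChanges

/-!
# Route LiouvilleSarnak — crux `LiouvilleCutRank` (stmt-ValiantsHypothesis-14775):
# a BALANCED WINDOW with few letter changes suffices (local form of `…BoundedChanges`)

`…BoundedChanges.le_rank_of_changes_le` bounds the rank from the number of letter changes of the WHOLE cut
word.  Through the window embedding (`OneScale.exists_inducedCut`, `OneScale.rank_inducedCut_le`) the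
hypothesis localises: it is enough that SOME balanced window `[s, s + 2n₁)` (`n₁ ≥ n₀(K, W)`) of the word has
at most `K` letter changes inside it — the rest of the word is arbitrary.

* ★ `le_rank_of_window_changes_le`.

Honest framing: corollary; `LiouvilleCutRank`, `DigitalBilinearLiouville`, `AlgebraicSarnak` stay OPEN; nothing
bears on `VP ≠ VNP`.  No definitions.
-/

set_option linter.dupNamespace false

noncomputable section

namespace Summit.ValiantsHypothesis.ValiantsHypothesis.Theorems.LiouvilleSarnakLiouvilleCutRank.BoundedChanges

open ArithmeticFunction Finset

open Summit.ValiantsHypothesis.ValiantsHypothesis.Theorems.LiouvilleSarnakLiouvilleCutRank.OneScale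
  (exists_inducedCut rank_inducedCut_le)

/-- ★ **A balanced window with `≤ K` letter changes forces rank `≥ W`.**  For all `K, W` there is `n₀` such
that at every level `n`, every cut `π` whose word `w` has a balanced window `[s, s + 2n₁)` (`n₁ ≥ n₀`,
exactly `n₁` row letters) with at most `K` letter changes inside (`#{k < 2n₁ - 1 : w(s+k) ≠ w(s+k+1)} ≤ K`)
has Liouville cut-matrix rank `≥ W`. [this file] -/
theorem le_rank_of_window_changes_le (K W : ℕ) : ∃ n₀ : ℕ, ∀ (n₁ : ℕ), n₀ ≤ n₁ →
    ∀ (n : ℕ) (π : Fin n ⊕ Fin n ≃ Fin (2 * n)) (w : ℕ → Bool),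
      (∀ j : Fin (2 * n), w j = (π.symm j).isLeft) →
      ∀ s : ℕ, s + 2 * n₁ ≤ 2 * n → Nat.count (fun k => w (s + k) = true) (2 * n₁) = n₁ →
      ((range (2 * n₁ - 1)).filter fun k => w (s + k) ≠ w (s + k + 1)).card ≤ K →
      W ≤ (Matrix.of fun r c : Fin n → Bool =>
        (((liouville (Nat.ofBits (fun k : Fin (2 * n) => Sum.elim r c (π.symm k)) + 1) : ℤ) :
          ℂ))).rank := by
  obtain ⟨n₀, hn₀⟩ := le_rank_of_changes_le K W
  refine ⟨n₀, fun n₁ hn₁ n π w hw s hs hcount hK => ?_⟩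
  obtain ⟨π₁, hπ₁⟩ := exists_inducedCut n₁ s w hcount
  have hemb := rank_inducedCut_le n₁ n π w s hs (fun j _ _ => hw j) π₁ hπ₁
  -- the induced word and its changes
  have h1 := hn₀ n₁ hn₁ π₁ (fun k => w (s + k)) (fun j => (hπ₁ j).symm) ?_
  · exact h1.trans hemb
  · refine le_trans (le_of_eq ?_) hK
    refine congrArg Finset.card (filter_congr fun k _ => ?_)
    rw [Nat.add_assoc]

end Summit.ValiantsHypothesis.ValiantsHypothesis.Theorems.LiouvilleSarnakLiouvilleCutRank.BoundedChanges

end
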